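import Literature.MathematicalPhysics.QuantumFieldTheory.Balaban1983to89.B8IdxB8SubDRigidity
import Literature.MathematicalPhysics.QuantumFieldTheory.Balaban1983to89.B9SupplySockB9P3ZdFrame

/-!
# `Balaban1983to89.B8Admissible134Sep22ZdDictionary` — [Balaban1985RegularSpaces] (1.4)₃ p. 77 «(Lʲη)⁻¹dist(Ω_jᶜ, Ω_{j+1}) > RM₁» (lit-balaban r13's
# `B8Eq134Admissible` ∕ r05's `B8SectAStatements.MetricClause14 supDist`) IS [Balaban1984PropagatorsII] (2.2) p. 224 «(Lʲη)⁻¹dist(Ω_jᶜ, Ω_{j+1}) > RM» (dag-n06-e's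
# `B9SupplySockB9P3ZdFrame.Sep22Zd`) ON THE `ℤᵈ` CARRIER, TRUNCATION BY TRUNCATION — the exact dictionary between print's (1.4) cut and N06's working key, and the
# STRICT inclusion «print's (1.3)–(1.4) class ⊊ the (2.2)-separated class» at matched constants (the big-cube clause (1.4)₂ is the difference)

statement-level skeleton of published theorems with citation tags; proofs where landed; nothing here is a claim about the
Yang–Mills mass gap

[Balaban1985RegularSpaces] ("B8", CMP **99** (1985) 75–102): (1.3)–(1.4) p. 77; [B6] = [Balaban1984PropagatorsII] (2.1)–(2.2) p. 224 («(Lʲη)⁻¹dist(Ω_jᶜ, Ω_{j+1}) > RM,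
M is a size of big blocks and R is a big positive integer fixed later»); [4] = [Balaban1985BackgroundPropagators] p. 399 («M and R sufficiently large»).
CITATION HEADER (lean-in-tree rule).  Cell `pub-ymgap` (HUMAN RULING D-0062 ∕ D-0149 width seats), DAG node N05 = [B8]; width seat `pub-ymgap-dag-n05-w2` (g5), 2026-08-28;
bears on K1⁹ `stmt-QuantumFields-27364` (`--kind proof --supports`, helper; count-neutral).  APPEND-ONLY discipline: a NEW importing module, SIBLING of this seat's
`B8IdxB8SubDPrintClassGap` (g5, p628350 — deliberately NOT imported: the two small faces it would lend, the coordinate reading of `cube_eq` and (2.2) at the cube tower,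
are re-derived here from r05 ∕ r13 ∕ dag-n06-e by name, so that either file builds without the other); NOTHING in `B8Eq134Admissible` (r13), `B8SectAStatements` (r05),
`B9SupplySockB9P3ZdFrame` (dag-n06-e), `B8IdxB8SubDRigidity` (this seat g4), `Node00/CarriersB8SubD` (dag-n05-w1) or below them is edited — everything CONSUMED BY NAME.

WHY THIS FILE.  `B8IdxB8SubDPrintClassGap` located that the (1.5)-keyed leaf index `IdxB8SubD θ` is strictly wider than BOTH print's literal (1.3)–(1.4)
(`Admissible134 L M₁ R k Ω`) and [B6] (2.2) (`Sep22Zd R (memZd M i m)`), and named the exit «cut the index to a supplier's class `κ` once N06 names it»; dag-n05-c g16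
(cell bus 2026-08-28 10:52Z) observed that print's cut and N06's working key «are DIFFERENT cuts».  This file settles how they differ, so that ONE cut can serve both:
(a) r13's `supDist` IS dag-n06-e's `linfDist` cast to `ℝ` (`rfl`); (b) for `L ≥ 1`, [B6] (2.2) at the member `memZd M i m` IS print's metric clause (1.4)₃ of the SAME domain
sequence at depth `m` with separation constant `R·⌈M⌉₊` (`sep22Zd_iff_metricClause14`); hence (c) print's (1.3)–(1.4) at `(M₁, R)` IMPLIES (2.2) at every truncation
`m ≤ k` and every real block parameter `M` with `⌈M⌉₊ ≤ M₁` (`sep22Zd_of_admissible134`) — a print-class cut serves every (2.2)-keyed supplier at matched constants — while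
(d) the converse fails: (2.2) does not see the big-cube clause (1.4)₂ (`exists_sep22Zd_not_admissible134`: print's Sect.-F tower with margin `ρ = R·M₁` but side ONE block
and corner `1` is (2.2)-separated at `(M₁, R)` and violates «Ω_j is a sum of cubes of a size M₁Lʲη» for every `M₁ ≥ 2`).

WHAT IS PROVED (0 sorry; proof lane — no `def`, no `instance`, no `notation`).
* §1 DICTIONARY: `supDist_eq_cast_linfDist` (`rfl`), `metricClause14_mono_depth` (the clause at depth `k` gives it at every `m ≤ k`), `metricClause14_mono_const`
  (anti-monotone in the product `R·M₁`), ★★ `sep22Zd_iff_metricClause14` (`1 ≤ L`: `Sep22Zd R (memZd M i m) ↔ MetricClause14 supDist i.Ω m 1 L R ⌈M⌉₊`),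
  `sep22Zd_natCast_iff_metricClause14` (`M := (M₁ : ℝ)`).
* §2 PRINT'S CLASS ⊆ N06's KEY: ★★ `sep22Zd_of_admissible134` (`Admissible134 L M₁ R k i.Ω → m ≤ k → ⌈M⌉₊ ≤ M₁ → Sep22Zd R (memZd M i m)`), and on the index of record
  ★ `IdxB8SubD.sep22Zd_of_admissible134` (every print-admissible member of `IdxB8SubD θ` is (2.2)-separated at every truncation `m ≤ k`, every `⌈M⌉₊ ≤ M₁`),
  ★★ `IdxB8SubD.admissible134_iff_sep22Zd` (on the index of record print's (1.3)–(1.4) at `(M₁, R)` ⟺ «`Ω_l = ∅` beyond `k`» ∧ (1.4)₂ ∧ `Sep22Zd R (memZd M₁ j k)` — the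
  (E2)-day cut predicate in N06's currency).
* §3 THE INCLUSION IS STRICT: `sep22Zd_cubeFam_natCast_of_le` ((2.2) at the Sect.-F tower for `R·M₁ ≤ ρ`, every `m ≤ k`), `loCorner_mem_cubeFam_top` ∕ `dropBlock_not_mem_cubeFam_top` ∕ `blockMap_dropBlock_eq` (the witness pair at the top level of the tower
  `cubeFam true L (fun _ ↦ 1) 1 ρ k`: the fine corners of the level-`k` blocks `1 − ρ` and `−ρ` of one axis share every `M₁Lᵏ`-cube when `M₁ ∣ ρ`, `M₁ ≥ 2`),
  ★ `not_bigCubes14_unitSide` (`2 ≤ M₁ → M₁ ∣ ρ → ¬ BigCubes14 L M₁ (cubeFam true L (fun _ ↦ 1) 1 ρ k)`), ★★ `exists_sep22Zd_not_admissible134` (`2 ≤ M₁`, `L ≤ R·M₁`, `2 ≤ k`: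
  a `ZdIdx`-free statement on the tower with `ρ := R·M₁` — `Sep22Zd R (memZd (M₁ : ℝ) i m)` for every datum `i` on it and every `2 ≤ m ≤ k`, yet `¬ Admissible134 L M₁ R k`),
  ★ `exists_idxB8SubD_sep22Zd_not_admissible134` (the same on the index of record `IdxB8SubD θ`, every depth `k ≥ 2`).

HONEST SCOPE.  Lattice bookkeeping (`Int` floor division, one explicit site pair) over r05 ∕ r13's cube family and dag-n06-e's frame, cited BY NAME; NO estimate; nothing
of Bałaban's asserted or refuted; no landed theorem is touched.  It says NOTHING about N06's other working laws ((T), (V), connectivity, `R⌈M⌉ ≥ max(N₀, 3 log L ∕ κ₂)`)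
— only the separation key.  Count-neutral; N05 NOT discharged; K1⁹ NOT claimed; one finite 𝕋⁴ programme at fixed ε, Bałaban AS PRINTED; the Yang–Mills mass gap (Clay)
is NOT proved by any of this — R4 closes the conditional finite-𝕋⁴ rung `BalabanLadder.UV` only; nothing continuum ∕ ℝ⁴ ∕ OS.  Unit `pub-ymgap-dag-n05-w2` (g5), 2026-08-28.
-/

noncomputable section

namespace Literature.MathematicalPhysics.QuantumFieldTheory.Balaban1983to89.B8Admissible134Sep22ZdDictionary

open B7Prop1Explicit B7Prop1Local
open Literature.MathematicalPhysics.QuantumLattice (blockMap)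
open B8LeafModelZd (ZdIdx)
open B8ConstraintBonds (DomainSeq)
open B8Eq131Cubes (cube cube_eq gs)
open B8Eq131CubesAdmissible (cubeFam cubeFam_domainSeq cubeFam_true_zero cubeFam_of_pos)
open B8SectAStatements (MetricClause14)
open B8Eq134Admissible (Admissible134 BigCubes14 supDist metricClause14_cubeFam)
open B9SupplySockB9P3ZdFrame (MemberZd memZd bigSideZd Sep22Zd)
open LatticeNorms (linfDist)
open B8IdxB8SubDRigidity (exists_idxB8SubD_cubeFam)
open Node00 (Stage3Params IdxB8SubD)

-- `Site` alone could resolve to the torus sites of `Setup.lean`; re-export the `ℤ^d` sites of `B7Prop1Explicit`.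
export B7Prop1Explicit (Site)

variable {d : ℕ}

/-! ## §1 The dictionary: r13's `supDist`∕`MetricClause14` versus dag-n06-e's `linfDist`∕`Sep22Zd` -/

section Dictionary

variable {L : ℕ}

/-- r13's `ℝ`-valued `ℓ^∞` lattice distance IS dag-n06-e's `ℕ`-valued one, cast (`rfl`: both are `Finset.univ.sup` of the coordinate gaps).
[cite: Balaban1985RegularSpaces, (1.4) p.77; Balaban1984PropagatorsII, (2.2) p.224] -/
theorem supDist_eq_cast_linfDist (x y : Site d) : supDist x y = ((linfDist x y : ℕ) : ℝ) := rfl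

/-- The metric clause at depth `k` gives it at every smaller depth `m ≤ k` (fewer levels quantified). [cite: Balaban1985RegularSpaces, (1.4) p.77] -/
theorem metricClause14_mono_depth {X : Type*} {ρ : X → X → ℝ} {Ω : ℕ → Set X} {k m : ℕ} (hmk : m ≤ k) {η : ℝ} {L R M₁ : ℕ}
    (h : MetricClause14 ρ Ω k η L R M₁) : MetricClause14 ρ Ω m η L R M₁ :=
  fun j hj => h j (lt_of_lt_of_le hj hmk)

/-- The metric clause is anti-monotone in the separation product `R·M₁` (only the product is read). [cite: Balaban1985RegularSpaces, (1.4) p.77 («R … sufficiently large»)] -/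
theorem metricClause14_mono_const {X : Type*} {ρ : X → X → ℝ} {Ω : ℕ → Set X} {k : ℕ} {η : ℝ} {L R M₁ R' M₁' : ℕ} (hle : R' * M₁' ≤ R * M₁)
    (h : MetricClause14 ρ Ω k η L R M₁) : MetricClause14 ρ Ω k η L R' M₁' := by
  intro j hj x hx y hy
  have h1 := h j hj x hx y hy
  have h2 : ((R' : ℝ) * M₁') ≤ (R : ℝ) * M₁ := by exact_mod_cast hle
  exact lt_of_le_of_lt h2 h1

/-- ★★ **[B6] (2.2) AT THE `ℤᵈ` MEMBER IS PRINT'S (1.4)₃ AT THE TRUNCATION** (`L ≥ 1`): for every datum `i`, block parameter `M` and truncation `m`,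
`Sep22Zd R (memZd M i m)` («every site outside `Ω_j` is more than `R·⌈M⌉₊·Lʲ` from `Ω_{j+1}` in sup-distance, `j + 1 ≤ m`») ↔ `MetricClause14 supDist i.Ω m 1 L R ⌈M⌉₊`
(«`R·⌈M⌉₊ < (Lʲ)⁻¹·dist`, `j < m`») — the same inequality over `ℕ` resp. `ℝ`. [cite: Balaban1984PropagatorsII, (2.2) p.224; Balaban1985RegularSpaces, (1.4) p.77] -/
theorem sep22Zd_iff_metricClause14 (hL : 1 ≤ L) (i : ZdIdx d L) (M : ℝ) (m R : ℕ) :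
    Sep22Zd R (memZd M i m) ↔ MetricClause14 supDist i.Ω m 1 L R ⌈M⌉₊ := by
  have hL0 : (0 : ℝ) < (L : ℝ) := by exact_mod_cast hL
  constructor
  · intro h j hj x hx y hy
    have h1 : R * (⌈M⌉₊ * L ^ j) < linfDist x y := h j (by simpa [memZd] using Nat.succ_le_of_lt hj) x (by simpa [memZd] using hx) y (by simpa [memZd] using hy)
    have h2 : ((R : ℝ) * ⌈M⌉₊) * (L : ℝ) ^ j < ((linfDist x y : ℕ) : ℝ) := by exact_mod_cast (show R * ⌈M⌉₊ * L ^ j < linfDist x y by simpa [mul_assoc] using h1)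
    have hLj : (0 : ℝ) < (L : ℝ) ^ j := pow_pos hL0 j
    rw [mul_one, supDist_eq_cast_linfDist, lt_inv_mul_iff₀ hLj]
    linarith [mul_comm ((L : ℝ) ^ j) ((R : ℝ) * ⌈M⌉₊)]
  · intro h j hj z hz z' hz'
    simp only [memZd] at hj hz hz'
    have h1 := h j (Nat.lt_of_succ_le hj) z hz z' hz'
    have hLj : (0 : ℝ) < (L : ℝ) ^ j := pow_pos hL0 j
    rw [mul_one, supDist_eq_cast_linfDist, lt_inv_mul_iff₀ hLj] at h1
    simp only [memZd, bigSideZd]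
    have h2 : ((R * (⌈M⌉₊ * L ^ j) : ℕ) : ℝ) < ((linfDist z z' : ℕ) : ℝ) := by
      push_cast at h1 ⊢; nlinarith [h1]
    exact_mod_cast h2

/-- The same with a natural block parameter `M := M₁` (`⌈(M₁ : ℝ)⌉₊ = M₁`). [cite: Balaban1984PropagatorsII, (2.2) p.224; Balaban1985RegularSpaces, (1.4) p.77] -/
theorem sep22Zd_natCast_iff_metricClause14 (hL : 1 ≤ L) (i : ZdIdx d L) (M₁ m R : ℕ) :
    Sep22Zd R (memZd (M₁ : ℝ) i m) ↔ MetricClause14 supDist i.Ω m 1 L R M₁ := by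
  rw [sep22Zd_iff_metricClause14 hL i (M₁ : ℝ) m R, Nat.ceil_natCast]

end Dictionary

/-! ## §2 Print's (1.3)–(1.4) class is INSIDE N06's (2.2)-separated class at matched constants -/

section PrintInside

variable {L : ℕ}

/-- ★★ **PRINT'S (1.3)–(1.4) AT `(M₁, R)` GIVES [B6] (2.2) AT EVERY TRUNCATION `m ≤ k` AND EVERY BLOCK PARAMETER `M` WITH `⌈M⌉₊ ≤ M₁`** (`L ≥ 1`): the metric clause of
`Admissible134`, restricted in depth and weakened in the constant, read through §1. [cite: Balaban1985RegularSpaces, (1.3)–(1.4) p.77; Balaban1984PropagatorsII, (2.2) p.224] -/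
theorem sep22Zd_of_admissible134 (hL : 1 ≤ L) {i : ZdIdx d L} {M₁ R k : ℕ} (h : Admissible134 L M₁ R k i.Ω) {m : ℕ} (hm : m ≤ k) {M : ℝ} (hM : ⌈M⌉₊ ≤ M₁) :
    Sep22Zd R (memZd M i m) :=
  (sep22Zd_iff_metricClause14 hL i M m R).2
    (metricClause14_mono_const (Nat.mul_le_mul_left R hM) (metricClause14_mono_depth hm h.metric))

/-- ★ **ON THE INDEX OF RECORD**: every member of the (1.5)-keyed leaf index `IdxB8SubD θ` that satisfies print's literal (1.3)–(1.4) at `(M₁, R)` is (2.2)-separated at every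
truncation `m ≤ k` for every `⌈M⌉₊ ≤ M₁` — a cut of the index to print's class serves every supplier keyed on dag-n06-e's `Sep22Zd R` at matched constants.
[cite: Balaban1985RegularSpaces, (1.3)–(1.5) p.77; Balaban1984PropagatorsII, (2.2) p.224] -/
theorem IdxB8SubD.sep22Zd_of_admissible134 {θ : Stage3Params} (j : IdxB8SubD θ) {M₁ R : ℕ} (h : Admissible134 θ.L M₁ R j.1.1.1.1.k j.1.1.1.1.Ω)
    {m : ℕ} (hm : m ≤ j.1.1.1.1.k) {M : ℝ} (hM : ⌈M⌉₊ ≤ M₁) : Sep22Zd R (memZd M j.1.1.1.1 m) :=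
  B8Admissible134Sep22ZdDictionary.sep22Zd_of_admissible134 (le_trans (by norm_num) θ.two_le_L) h hm hM

/-- ★★ **WHAT A PRINT-CLASS CUT ASKS OF A MEMBER OF TODAY'S INDEX, IN N06's CURRENCY**: for `j : IdxB8SubD θ` (nesting and `Lʲ`-block saturation are already laws
of the index — `IdxB8SubD.domainSeq`), print's literal (1.3)–(1.4) at `(M₁, R)` is EQUIVALENT to: the sequence stops at depth `k` (`Ω_l = ∅`, `l > k`) ∧ the big-cube
clause (1.4)₂ ∧ [B6] (2.2) `Sep22Zd R` at block parameter `M₁` and the TOP truncation `m = k`.  The (E2)-day predicate, read both ways.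
[cite: Balaban1985RegularSpaces, (1.3)–(1.5) p.77; Balaban1984PropagatorsII, (2.2) p.224] -/
theorem IdxB8SubD.admissible134_iff_sep22Zd {θ : Stage3Params} (j : IdxB8SubD θ) (M₁ R : ℕ) :
    Admissible134 θ.L M₁ R j.1.1.1.1.k j.1.1.1.1.Ω ↔
      (∀ l, j.1.1.1.1.k < l → j.1.1.1.1.Ω l = ∅) ∧ BigCubes14 θ.L M₁ j.1.1.1.1.Ω ∧ Sep22Zd R (memZd (M₁ : ℝ) j.1.1.1.1 j.1.1.1.1.k) := by
  have hL : 1 ≤ θ.L := le_trans (by norm_num) θ.two_le_L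
  rw [sep22Zd_natCast_iff_metricClause14 hL]
  exact ⟨fun h => ⟨h.beyond, h.bigCubes, h.metric⟩, fun h => ⟨j.domainSeq.anti, h.1, j.domainSeq.sat, h.2.1, h.2.2⟩⟩

end PrintInside

/-! ## §3 The inclusion is strict: a (2.2)-separated tower violating the big-cube clause (1.4)₂ -/

section Strict

variable {L : ℕ}

/-- Membership in a cube of the Sect.-F tower, coordinate-wise (`cube_eq` unfolded; private twin of `B8IdxB8SubDPrintClassGap.mem_cube_iff_coord`).
[cite: Balaban1985RegularSpaces, (1.131) p.99] -/
private theorem mem_cube_iff_coord' {a : Site d} {M ρ k j : ℕ} (hj : j ≤ k) (x : Site d) :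
    x ∈ cube L a M ρ k j ↔
      ∀ i, (L : ℤ) ^ k * a i - ((L ^ j * (ρ * gs L (k - j)) : ℕ) : ℤ) ≤ x i ∧
        x i ≤ (L : ℤ) ^ k * (a i + M) - 1 + ((L ^ j * (ρ * gs L (k - j)) : ℕ) : ℤ) := by
  rw [cube_eq hj]
  simp only [Set.mem_setOf_eq, InBox, B8Eq131Cubes.bLo, B8Eq131Cubes.bHi]

/-- (2.2) at print's Sect.-F tower `cubeFam true L a M ρ k` with a natural block parameter `M₁`, every truncation `m ≤ k`, whenever `R·M₁ ≤ ρ` — r13's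
`metricClause14_cubeFam` read through §1 (the `top = true` sibling of dag-n06-w2's `B9BlockLawsCubeMemberZd.sep22_cube`; the IFF is this seat's
`B8IdxB8SubDPrintClassGap.sep22Zd_cubeFam_iff`). [cite: Balaban1984PropagatorsII, (2.2) p.224; Balaban1985RegularSpaces, p.98] -/
theorem sep22Zd_cubeFam_natCast_of_le (hL : 1 ≤ L) {a : Site d} {M ρ k : ℕ} (i : ZdIdx d L) (hΩ : i.Ω = cubeFam true L a M ρ k)
    {m : ℕ} (hmk : m ≤ k) {R M₁ : ℕ} (hRM : R * M₁ ≤ ρ) : Sep22Zd R (memZd (M₁ : ℝ) i m) := by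
  rw [sep22Zd_natCast_iff_metricClause14 hL, hΩ]
  exact metricClause14_mono_depth hmk (metricClause14_cubeFam true hL a M k hRM)

/-- The lower corner `(Lᵏ(1 − ρ), …)` of `□_k` of the tower `cubeFam true L (fun _ ↦ 1) 1 ρ k` lies in `□_k` (`1 ≤ L`, `1 ≤ k`). [cite: Balaban1985RegularSpaces, (1.131) p.99] -/
theorem loCorner_mem_cubeFam_top (hL : 1 ≤ L) {ρ k : ℕ} (hk : 1 ≤ k) :
    (fun _ : Fin d => (L : ℤ) ^ k * 1 - ((L ^ k * (ρ * gs L (k - k)) : ℕ) : ℤ)) ∈ cubeFam true L (fun _ : Fin d => (1 : ℤ)) 1 ρ k k := by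
  rw [cubeFam_of_pos true L _ 1 ρ hk le_rfl, mem_cube_iff_coord' le_rfl]
  intro i
  refine ⟨le_rfl, ?_⟩
  have hLk : (1 : ℤ) ≤ (L : ℤ) ^ k := by exact_mod_cast Nat.one_le_pow k L hL
  have hμ : (0 : ℤ) ≤ ((L ^ k * (ρ * gs L (k - k)) : ℕ) : ℤ) := by positivity
  push_cast at hμ ⊢
  nlinarith

/-- Lowering the coordinate `i₀` of that corner by one level-`k` block leaves `□_k`. [cite: Balaban1985RegularSpaces, (1.131) p.99] -/
theorem dropBlock_not_mem_cubeFam_top {ρ k : ℕ} (hk : 1 ≤ k) (hL : 1 ≤ L) (i₀ : Fin d) :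
    (fun i : Fin d => if i = i₀ then (L : ℤ) ^ k * 1 - ((L ^ k * (ρ * gs L (k - k)) : ℕ) : ℤ) - (L : ℤ) ^ k
      else (L : ℤ) ^ k * 1 - ((L ^ k * (ρ * gs L (k - k)) : ℕ) : ℤ)) ∉ cubeFam true L (fun _ : Fin d => (1 : ℤ)) 1 ρ k k := by
  rw [cubeFam_of_pos true L _ 1 ρ hk le_rfl, mem_cube_iff_coord' le_rfl]
  intro h
  have h1 := (h i₀).1
  simp only [if_true] at h1
  have hLk : (1 : ℤ) ≤ (L : ℤ) ^ k := by exact_mod_cast Nat.one_le_pow k L hL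
  linarith

/-- For `M₁ ∣ ρ` the two corners share their `M₁Lᵏ`-cube label when `M₁ ≥ 2`: with `ρ = M₁·q`, `⌊Lᵏ(1 − ρ) ∕ (M₁Lᵏ)⌋ = −q = ⌊(Lᵏ(1 − ρ) − Lᵏ) ∕ (M₁Lᵏ)⌋`.
[cite: Balaban1985RegularSpaces, (1.4) p.77 («cubes of a size M₁Lʲη»; bookkeeping)] -/
theorem blockMap_dropBlock_eq (hL : 1 ≤ L) {k M₁ ρ : ℕ} (hM₁ : 2 ≤ M₁) (hdvd : M₁ ∣ ρ) (i₀ : Fin d) :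
    blockMap (M₁ * L ^ k) (fun _ : Fin d => (L : ℤ) ^ k * 1 - ((L ^ k * (ρ * gs L (k - k)) : ℕ) : ℤ)) =
      blockMap (M₁ * L ^ k) (fun i : Fin d => if i = i₀ then (L : ℤ) ^ k * 1 - ((L ^ k * (ρ * gs L (k - k)) : ℕ) : ℤ) - (L : ℤ) ^ k
        else (L : ℤ) ^ k * 1 - ((L ^ k * (ρ * gs L (k - k)) : ℕ) : ℤ)) := by
  obtain ⟨q, rfl⟩ := hdvd
  have hμ : ((L ^ k * (M₁ * q * gs L (k - k)) : ℕ) : ℤ) = (q : ℤ) * ((M₁ * L ^ k : ℕ) : ℤ) := by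
    rw [Nat.sub_self, B8Eq131Cubes.gs_zero, mul_one]; push_cast; ring
  have hc : ((M₁ * L ^ k : ℕ) : ℤ) ≠ 0 := by
    have : 0 < M₁ * L ^ k := by positivity
    exact_mod_cast this.ne'
  have hLk : (0 : ℤ) ≤ (L : ℤ) ^ k := by positivity
  have hlt : (L : ℤ) ^ k < ((M₁ * L ^ k : ℕ) : ℤ) := by
    push_cast
    have hLk' : (0 : ℤ) < (L : ℤ) ^ k := by positivity
    nlinarith
  funext i
  simp only [blockMap]
  by_cases hi : i = i₀
  · simp only [hi, if_true]
    rw [hμ, show (L : ℤ) ^ k * 1 - (q : ℤ) * ((M₁ * L ^ k : ℕ) : ℤ) = (L : ℤ) ^ k + (-(q : ℤ)) * ((M₁ * L ^ k : ℕ) : ℤ) by ring,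
      show (L : ℤ) ^ k + (-(q : ℤ)) * ((M₁ * L ^ k : ℕ) : ℤ) - (L : ℤ) ^ k = 0 + (-(q : ℤ)) * ((M₁ * L ^ k : ℕ) : ℤ) by ring,
      Int.add_mul_ediv_right _ _ hc, Int.add_mul_ediv_right _ _ hc, Int.ediv_eq_zero_of_lt hLk hlt, Int.zero_ediv]
  · simp [hi]

/-- ★ **THE BIG-CUBE CLAUSE (1.4)₂ FAILS AT THE UNIT-SIDE TOWER FOR EVERY `M₁ ≥ 2` DIVIDING THE MARGIN**: `¬ BigCubes14 L M₁ (cubeFam true L (fun _ ↦ 1) 1 ρ k)` (`M₁ ∣ ρ`,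
`1 ≤ k`, `1 ≤ L`) — the level-`k` cube is the block box `[1 − ρ, 2 + ρ)ᵈ`, whose lower face is not `M₁`-aligned. [cite: Balaban1985RegularSpaces, (1.4) p.77, (1.131) p.99] -/
theorem not_bigCubes14_unitSide (hd : 0 < d) (hL : 1 ≤ L) {k : ℕ} (hk : 1 ≤ k) {M₁ ρ : ℕ} (hM₁ : 2 ≤ M₁) (hdvd : M₁ ∣ ρ) :
    ¬ BigCubes14 L M₁ (cubeFam true L (fun _ : Fin d => (1 : ℤ)) 1 ρ k) := fun h =>
  dropBlock_not_mem_cubeFam_top hk hL ⟨0, hd⟩ (h k _ _ (blockMap_dropBlock_eq hL hM₁ hdvd ⟨0, hd⟩) (loCorner_mem_cubeFam_top hL hk))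

/-- ★★ **THE (2.2)-SEPARATED CLASS IS STRICTLY WIDER THAN PRINT'S (1.3)–(1.4) AT MATCHED CONSTANTS** (`2 ≤ M₁`, `L ≤ R·M₁`, `2 ≤ k`, `1 ≤ L`, `d ≥ 1`): the tower
`cubeFam true L (fun _ ↦ 1) 1 (R·M₁) k` is `Sep22Zd R`-separated at block parameter `M₁` for every datum on it and every truncation `2 ≤ m ≤ k` (this seat's g5
`sep22Zd_cubeFam_iff`: `R·M₁ ≤ ρ`), is a `DomainSeq` (`ρ = R·M₁ ≥ L` assumed), and violates `Admissible134 L M₁ R k` (its big-cube clause).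
[cite: Balaban1984PropagatorsII, (2.2) p.224; Balaban1985RegularSpaces, (1.3)–(1.4) p.77, (1.131) p.99] -/
theorem exists_sep22Zd_not_admissible134 (hd : 0 < d) (hL : 1 ≤ L) {M₁ R : ℕ} (hM₁ : 2 ≤ M₁) (hRM : L ≤ R * M₁) {k : ℕ} (hk : 2 ≤ k) :
    DomainSeq L (cubeFam true L (fun _ : Fin d => (1 : ℤ)) 1 (R * M₁) k) ∧
      (∀ i : ZdIdx d L, i.Ω = cubeFam true L (fun _ : Fin d => (1 : ℤ)) 1 (R * M₁) k → ∀ m, 2 ≤ m → m ≤ k → Sep22Zd R (memZd (M₁ : ℝ) i m)) ∧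
      ¬ Admissible134 L M₁ R k (cubeFam true L (fun _ : Fin d => (1 : ℤ)) 1 (R * M₁) k) := by
  refine ⟨cubeFam_domainSeq true hL _ 1 hRM k, fun i hΩ m _ hmk => sep22Zd_cubeFam_natCast_of_le hL i hΩ hmk le_rfl, fun hA => ?_⟩
  exact not_bigCubes14_unitSide hd hL (by omega) hM₁ (dvd_mul_left M₁ R) hA.bigCubes

/-- ★ **THE SAME ON THE INDEX OF RECORD**: for `2 ≤ M₁`, `θ.L ≤ R·M₁` and every depth `k ≥ 2` there is a member `j` of `IdxB8SubD θ` of depth `k` that is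
(2.2)-separated at `(M₁, R)` at every truncation `2 ≤ m ≤ k` and violates print's (1.3)–(1.4) at `(M₁, R)` — so the three classes are nested STRICTLY:
print's (1.3)–(1.4) ⊊ [B6] (2.2)-separated ⊊ the index of record (the last by `B8IdxB8SubDPrintClassGap.exists_idxB8SubD_not_sep22Zd`).
[cite: Balaban1985RegularSpaces, (1.3)–(1.5) p.77, (1.131) p.99; Balaban1984PropagatorsII, (2.2) p.224] -/
theorem exists_idxB8SubD_sep22Zd_not_admissible134 (θ : Stage3Params) {M₁ R : ℕ} (hM₁ : 2 ≤ M₁) (hRM : θ.L ≤ R * M₁) {k : ℕ} (hk : 2 ≤ k) :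
    ∃ j : IdxB8SubD θ, j.1.1.1.1.k = k ∧ (∀ m, 2 ≤ m → m ≤ k → Sep22Zd R (memZd (M₁ : ℝ) j.1.1.1.1 m)) ∧
      ¬ Admissible134 θ.L M₁ R k j.1.1.1.1.Ω := by
  have hL : 1 ≤ θ.L := le_trans (by norm_num) θ.two_le_L
  have hd : 0 < θ.D := by rw [← θ.hd₆]; exact Nat.succ_pos _
  obtain ⟨j, -, hjk, hΩ, -⟩ := exists_idxB8SubD_cubeFam θ (fun _ => (1 : ℤ)) 1 hRM (show 1 ≤ k by omega)
  obtain ⟨-, hsep, hnot⟩ := exists_sep22Zd_not_admissible134 hd hL hM₁ hRM hk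
  exact ⟨j, hjk, fun m hm2 hmk => hsep j.1.1.1.1 hΩ m hm2 hmk, by rw [hΩ]; exact hnot⟩

end Strict

end Literature.MathematicalPhysics.QuantumFieldTheory.Balaban1983to89.B8Admissible134Sep22ZdDictionary

end
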